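import Summits.QuantumAdvantage.QuantumAdvantage.Theorems.CubicForrelationNearExactIsExactTwelveZ768Core
import Summits.QuantumAdvantage.QuantumAdvantage.Theorems.CubicForrelationNearExactIsExactTwelveLevelSixBothLe5764

/-!
# Crux `CubicForrelation.NearExactIsExact` (stmt-QuantumAdvantage-14043) — n = 12, level-`≥ 6` side on the OPEN window: Parseval bridges
  to the partner, and what a type-O / level-5 partner costs

Certificate seat `b2b-cforr-cert` (gen 27).  HONEST FRAMING: finite-slice lemmas (standard axioms) about cubic Boolean pairs on 12 bits; tools for
"no level-`≥ 6` side on the open window `57/64 < Φ < 29/32`" (…TwelveLevelSixWindowDead).  NO value of `θ₁₂` claimed; NOT summit progress.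

* `tzp_ehat`: the duality for ANY partner, `ê(y) = Σ_x (u'' − (−1)^f)(x)(−1)^{x·y} = 64(−1)^{g(y)} − W_f(y)` (Walsh inversion `tz_inversion`).
* `tzp_bridge512`: `#Z = 512` (9-flat `x_Z ⊕ V₀`), `57/64 < Φ`: `Σ_y (64(−1)^g − W_f − M)² ≤ 4096·507`, `M` the sign character sum of
  …TwelveZ512SignAffine (Parseval for `π = e − σ1_Z` + `tzc_pi_sq_le`).
* `tzp_bridge768`: `#Z = 768`, `4 ∣ e` off `Z`, `57/64 < Φ`: for some integer `K(y)`, `Σ_y (64(−1)^g − W_f − 128K)² ≤ 4096·254` (`tzq_Z768_core`).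
* `tzp_typeO_struct`: a TYPE-O partner `f` (`W_f = 16u`, some `u` odd) has all `u` odd and a set `E` of `≥ 512` points with `u ≡ ±1 (mod 8)`
  (digits `z2_digitOne/Two`, `no_caseA`, Reed–Muller weight) — there `|u − 4s| ≥ 3` for `s = ±1`.
* `tzp_levelFive_card`: a LEVEL-5 partner (`W_f = 32u′`, some `u′` odd) has `u′` odd on `≥ 2048` points (Walsh tower + Reed–Muller weight).
* `tzp_Z_card`, `tzp_flat512`: on the window a level-`≥ 6` side has `#Z ∈ {512, 768}` (Kasami–Tokura, no partner hypothesis), and `#Z = 512`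
  makes `Z` a 9-flat `x_Z ⊕ V₀`.

References: MacWilliams–Sloane (1977) Ch. 13–15; T. Kasami, N. Tokura (1970); R. O'Donnell (2014) §1.4, §3.3.  Axioms: the standard three.
-/

set_option linter.dupNamespace false -- D-0017: single-problem summit ⇒ `QuantumAdvantage.QuantumAdvantage` by design

noncomputable section

namespace Summit.QuantumAdvantage.QuantumAdvantage.Theorems.CubicForrelation.NearExactIsExact

open Finset
open Literature.Computability.QuantumComplexity
open Literature.Computability.QuantumComplexity.BuzetChailloux (bxor zeroVec bxor_bxor_cancel_left bxor_zeroVec zeroVec_bxor bxor_comm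
  bxor_self)
open Literature.Computability.QuantumComplexity.DerivativeWalsh (W sum_W_sq)
open Summit.QuantumAdvantage.QuantumAdvantage.Theorems.NearExactIsExact.Negative (TypeOTwelve.no_caseA TypeOTwelve.typeO_of_exists_odd)

/-! ### The duality for an arbitrary partner -/

/-- **`ê(y) = 64(−1)^{g(y)} − W_f(y)`** for `W_g = 64u''` and ANY Boolean `f` (Walsh inversion). [folklore] -/
theorem tzp_ehat (f g : (Fin (6 + 6) → Bool) → Bool)
    (u'' : (Fin (6 + 6) → Bool) → ℤ) (hu'' : ∀ x, W (fun y => signOf (g y)) x = (2 : ℝ) ^ 6 * (u'' x : ℝ)) (y : Fin (6 + 6) → Bool) :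
    ∑ a, (((u'' a - sZ (f a) : ℤ)) : ℝ) * twist a y = 64 * signOf (g y) - W (fun x => signOf (f x)) y := by
  have hinv := tz_inversion (fun t => signOf (g t)) y
  have h1 : ∑ a, ((u'' a : ℤ) : ℝ) * twist a y = 64 * signOf (g y) := by
    have h' : ∑ a, ((u'' a : ℤ) : ℝ) * twist a y = (∑ a, W (fun t => signOf (g t)) a * twist a y) / 2 ^ 6 := by
      rw [eq_div_iff (by norm_num), sum_mul]
      exact sum_congr rfl fun a _ => by rw [hu'' a]; ring
    rw [h', hinv]; norm_num; ring
  have h2 : ∑ a, (((u'' a - sZ (f a) : ℤ)) : ℝ) * twist a y = ∑ a, ((u'' a : ℤ) : ℝ) * twist a y - ∑ a, signOf (f a) * twist a y := by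
    rw [← sum_sub_distrib]; exact sum_congr rfl fun a _ => by push_cast; rw [tp_sZ_cast]; ring
  rw [h2, h1]
  rfl

/-! ### Parseval bridges -/

/-- **Bridge for `#Z = 512`**: `Σ_y (64(−1)^{g(y)} − W_f(y) − M(y))² ≤ 4096·507`, `M(y) = Σ_{x∈Z} σ(x)(−1)^{x·y}` the sign character sum.
Finite-slice statement, NOT summit progress. [this work] -/
theorem tzp_bridge512 (f g : (Fin (6 + 6) → Bool) → Bool) (hf : IsDegLeFun 3 f) (hg : IsDegLeFun 3 g)
    (u'' : (Fin (6 + 6) → Bool) → ℤ) (hu'' : ∀ x, W (fun y => signOf (g y)) x = (2 : ℝ) ^ 6 * (u'' x : ℝ))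
    (V₀ : Finset (Fin (6 + 6) → Bool)) (xZ : Fin (6 + 6) → Bool) (h0 : zeroVec ∈ V₀)
    (hadd : ∀ a ∈ V₀, ∀ b ∈ V₀, bxor a b ∈ V₀) (hcardV : #V₀ = 512)
    (hS : (univ.filter fun x : Fin (6 + 6) → Bool => ¬ Odd (u'' x)) = V₀.image (bxor xZ))
    (hlo : (57 / 64 : ℝ) < forrelation f g) :
    ∑ y, (64 * signOf (g y) - W (fun x => signOf (f x)) y -
      ∑ x ∈ (univ.filter fun x : Fin (6 + 6) → Bool => ¬ Odd (u'' x)), signOf (decide ((u'' x - sZ (f x)) % 4 = 3)) * twist x y) ^ 2 ≤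
      4096 * 507 := by
  classical
  set Z := univ.filter (fun x : Fin (6 + 6) → Bool => ¬ Odd (u'' x)) with hZdef
  set e : (Fin (6 + 6) → Bool) → ℤ := fun x => u'' x - sZ (f x) with hedef
  set hb : (Fin (6 + 6) → Bool) → Bool := fun x => decide (e x % 4 = 3) with hbdef
  set S : (Fin (6 + 6) → Bool) → ℤ := fun x => if x ∈ Z then sZ (hb x) else 0 with hSdef
  have hpi : (∑ x, (e x - S x) ^ 2 : ℤ) ≤ 507 := tzc_pi_sq_le f g hf hg u'' hu'' V₀ xZ h0 hadd hcardV hS hlo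
  have hShat : ∀ y, ∑ a, ((S a : ℤ) : ℝ) * twist a y = ∑ x ∈ Z, signOf (hb x) * twist x y := by
    intro y
    have hres : ∑ a, ((S a : ℤ) : ℝ) * twist a y = ∑ a ∈ Z, ((S a : ℤ) : ℝ) * twist a y := by
      symm
      apply sum_subset (subset_univ Z)
      intro x _ hx
      simp only [S]; rw [if_neg hx]; simp
    rw [hres]
    exact sum_congr rfl fun x hx => by simp only [S]; rw [if_pos hx, tp_sZ_cast]
  have hW : ∀ y, W (fun a => (((e a - S a : ℤ)) : ℝ)) y = 64 * signOf (g y) - W (fun x => signOf (f x)) y - ∑ x ∈ Z, signOf (hb x) * twist x y := by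
    intro y
    show ∑ a, (((e a - S a : ℤ)) : ℝ) * twist a y = _
    have h1 : ∑ a, (((e a - S a : ℤ)) : ℝ) * twist a y = ∑ a, ((e a : ℤ) : ℝ) * twist a y - ∑ a, ((S a : ℤ) : ℝ) * twist a y := by
      rw [← sum_sub_distrib]; exact sum_congr rfl fun x _ => by push_cast; ring
    rw [h1, hShat y]
    have h2 : ∑ a, ((e a : ℤ) : ℝ) * twist a y = 64 * signOf (g y) - W (fun x => signOf (f x)) y := tzp_ehat f g u'' hu'' y
    rw [h2]
  have hP := sum_W_sq (fun a => (((e a - S a : ℤ)) : ℝ))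
  simp_rw [hW] at hP
  have hrhs : (2 : ℝ) ^ (6 + 6) * ∑ x, ((((e x - S x : ℤ)) : ℝ)) ^ 2 ≤ 4096 * 507 := by
    have h1 : ∑ x, ((((e x - S x : ℤ)) : ℝ)) ^ 2 = ((∑ x, (e x - S x) ^ 2 : ℤ) : ℝ) := by push_cast; rfl
    rw [h1]
    have h2 : ((∑ x, (e x - S x) ^ 2 : ℤ) : ℝ) ≤ 507 := by exact_mod_cast hpi
    rw [show ((2 : ℝ) ^ (6 + 6)) = 4096 by norm_num]
    linarith
  rw [hP]
  exact hrhs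

/-- **Bridge for `#Z = 768`**: with `4 ∣ e` off `Z` there is an integer function `K` with `Σ_y (64(−1)^{g(y)} − W_f(y) − 128K(y))² ≤ 4096·254`.
Finite-slice statement, NOT summit progress. [this work] -/
theorem tzp_bridge768 (f g : (Fin (6 + 6) → Bool) → Bool) (hf : IsDegLeFun 3 f) (hg : IsDegLeFun 3 g)
    (u'' : (Fin (6 + 6) → Bool) → ℤ) (hu'' : ∀ x, W (fun y => signOf (g y)) x = (2 : ℝ) ^ 6 * (u'' x : ℝ))
    (h768 : #(univ.filter fun x : Fin (6 + 6) → Bool => ¬ Odd (u'' x)) = 768)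
    (h4off : ∀ y, y ∉ (univ.filter fun x : Fin (6 + 6) → Bool => ¬ Odd (u'' x)) → (4 : ℤ) ∣ u'' y - sZ (f y))
    (hlo : (57 / 64 : ℝ) < forrelation f g) :
    ∃ K : (Fin (6 + 6) → Bool) → ℤ, ∑ y, (64 * signOf (g y) - W (fun x => signOf (f x)) y - 128 * (K y : ℝ)) ^ 2 ≤ 4096 * 254 := by
  classical
  set Z := univ.filter (fun x : Fin (6 + 6) → Bool => ¬ Odd (u'' x)) with hZdef
  set e : (Fin (6 + 6) → Bool) → ℤ := fun x => u'' x - sZ (f x) with hedef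
  set S : (Fin (6 + 6) → Bool) → ℤ := fun x => if x ∈ Z then sZ (decide ((4 : ℤ) ∣ e x + 1)) else 0 with hSdef
  obtain ⟨hK, hpi⟩ := tzq_Z768_core f g hf hg u'' hu'' h768 h4off hlo S
    (fun x hx => by simp only [S]; rw [if_pos hx]) (fun y hy => by simp only [S]; rw [if_neg hy])
  choose K hK using hK
  refine ⟨K, ?_⟩
  have hW : ∀ y, W (fun a => (((e a - S a : ℤ)) : ℝ)) y = 64 * signOf (g y) - W (fun x => signOf (f x)) y - 128 * (K y : ℝ) := by
    intro y
    show ∑ a, (((e a - S a : ℤ)) : ℝ) * twist a y = _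
    have h1 : ∑ a, (((e a - S a : ℤ)) : ℝ) * twist a y = ∑ a, ((e a : ℤ) : ℝ) * twist a y - ∑ a, ((S a : ℤ) : ℝ) * twist a y := by
      rw [← sum_sub_distrib]; exact sum_congr rfl fun x _ => by push_cast; ring
    rw [h1, hK y]
    have h2 : ∑ a, ((e a : ℤ) : ℝ) * twist a y = 64 * signOf (g y) - W (fun x => signOf (f x)) y := tzp_ehat f g u'' hu'' y
    rw [h2]
  have hP := sum_W_sq (fun a => (((e a - S a : ℤ)) : ℝ))
  simp_rw [hW] at hP
  have hrhs : (2 : ℝ) ^ (6 + 6) * ∑ x, ((((e x - S x : ℤ)) : ℝ)) ^ 2 ≤ 4096 * 254 := by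
    have h1 : ∑ x, ((((e x - S x : ℤ)) : ℝ)) ^ 2 = ((∑ x, (e x - S x) ^ 2 : ℤ) : ℝ) := by push_cast; rfl
    rw [h1]
    have h2 : ((∑ x, (e x - S x) ^ 2 : ℤ) : ℝ) ≤ 254 := by exact_mod_cast hpi
    rw [show ((2 : ℝ) ^ (6 + 6)) = 4096 by norm_num]
    linarith
  rw [hP]
  exact hrhs

/-! ### What a type-O or level-5 partner looks like -/

/-- The two low digits of an odd integer: `[⌊u/2⌋ odd] = [⌊u/4⌋ odd]` iff `u ≡ ±1 (mod 8)`. [folklore] -/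
theorem tzp_digits (u : ℤ) (hu : Odd u) :
    (((decide (Odd (u / 2)) ^^ decide (Odd (u / 2 / 2))) ^^ true) = true ↔ (u % 8 = 1 ∨ u % 8 = 7)) := by
  have h0 := Int.odd_iff.1 hu
  by_cases h1 : Odd (u / 2) <;> by_cases h2 : Odd (u / 2 / 2)
  · rw [decide_eq_true h1, decide_eq_true h2]
    have h1' := Int.odd_iff.1 h1; have h2' := Int.odd_iff.1 h2
    simp only [show (((true ^^ true) ^^ true) = true) ↔ True from by decide, true_iff]
    omega
  · rw [decide_eq_true h1, decide_eq_false h2]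
    have h1' := Int.odd_iff.1 h1; have h2' := Int.even_iff.1 (Int.not_odd_iff_even.1 h2)
    simp only [show (((true ^^ false) ^^ true) = true) ↔ False from by decide, false_iff]
    omega
  · rw [decide_eq_false h1, decide_eq_true h2]
    have h1' := Int.even_iff.1 (Int.not_odd_iff_even.1 h1); have h2' := Int.odd_iff.1 h2
    simp only [show (((false ^^ true) ^^ true) = true) ↔ False from by decide, false_iff]
    omega
  · rw [decide_eq_false h1, decide_eq_false h2]
    have h1' := Int.even_iff.1 (Int.not_odd_iff_even.1 h1); have h2' := Int.even_iff.1 (Int.not_odd_iff_even.1 h2)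
    simp only [show (((false ^^ false) ^^ true) = true) ↔ True from by decide, true_iff]
    omega

/-- **Type-O structure**: cubic `f` on 12 bits with `W_f = 16u` and some `u(y)` odd: every `u(y)` is odd, and the set
`E = {y : u(y) ≡ ±1 (mod 8)}` has at least `512` points.  (Digits `d₁` affine, `d₂` cubic; `E = {d₁ = d₂}` is a non-zero cubic support by
`no_caseA`; Reed–Muller weight.) [this work] -/
theorem tzp_typeO_struct (f : (Fin (6 + 6) → Bool) → Bool) (hf : IsDegLeFun 3 f)
    (u : (Fin (6 + 6) → Bool) → ℤ) (hu : ∀ y, W (fun x => signOf (f x)) y = (2 : ℝ) ^ 4 * (u y : ℝ)) (hodd : ∃ y, Odd (u y)) :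
    (∀ y, Odd (u y)) ∧ 512 ≤ #(univ.filter fun y : Fin (6 + 6) → Bool => u y % 8 = 1 ∨ u y % 8 = 7) := by
  classical
  have hall : ∀ y, Odd (u y) := TypeOTwelve.typeO_of_exists_odd f u hf hu hodd
  refine ⟨hall, ?_⟩
  have hu' : ∀ y, W (fun x => signOf (f x)) y = (2 : ℝ) ^ (2 * 2) * (u y : ℝ) := fun y => (hu y).trans (by norm_num)
  have hd1 : IsDegLeFun 1 (fun y => decide (Odd (u y / 2))) := z2_digitOne 2 f u hf hu' hall
  have hd2 : IsDegLeFun 3 (fun y => decide (Odd (u y / 2 / 2))) := z2_digitTwo 2 f u hf hu' hall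
  have hdegE : IsDegLeFun (2 + 1) (fun y => (decide (Odd (u y / 2)) ^^ decide (Odd (u y / 2 / 2))) ^^ true) :=
    tb_isDegLeFun_xor_const (bb_isDegLeFun_bxor (hd1.mono (by norm_num)) hd2) true
  have hsetE : (univ.filter fun y : Fin (6 + 6) → Bool =>
      ((decide (Odd (u y / 2)) ^^ decide (Odd (u y / 2 / 2))) ^^ true) = true) =
      (univ.filter fun y : Fin (6 + 6) → Bool => u y % 8 = 1 ∨ u y % 8 = 7) :=
    filter_congr fun y _ => tzp_digits (u y) (hall y)
  have hne : ∃ y, ((decide (Odd (u y / 2)) ^^ decide (Odd (u y / 2 / 2))) ^^ true) = true := by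
    by_contra hnone
    push Not at hnone
    refine TypeOTwelve.no_caseA f u hf hu fun y => ?_
    have h0 := Int.odd_iff.1 (hall y)
    have hy := (not_congr (tzp_digits (u y) (hall y))).1 (hnone y)
    omega
  have hRM := bb_rmWeight_holds (6 + 6) (2 + 1) _ hdegE hne
  rw [hsetE] at hRM
  norm_num at hRM
  omega

/-- **Level-5 structure**: cubic `f` on 12 bits with `W_f = 32u′` and some `u′(y)` odd: `u′` is odd on at least `2048` points (the odd set is
a non-zero affine support). [this work] -/
theorem tzp_levelFive_card (f : (Fin (6 + 6) → Bool) → Bool) (hf : IsDegLeFun 3 f)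
    (u' : (Fin (6 + 6) → Bool) → ℤ) (hu' : ∀ y, W (fun x => signOf (f x)) y = (2 : ℝ) ^ 5 * (u' y : ℝ)) (hodd : ∃ y, Odd (u' y)) :
    2048 ≤ #(univ.filter fun y : Fin (6 + 6) → Bool => Odd (u' y)) := by
  classical
  have hdeg : IsDegLeFun 1 (fun y => decide (Odd (u' y))) :=
    stub_walshTower stub_axParity (6 + 6) 5 1 f u' hf hu' (by intro k hk hkn; omega)
  obtain ⟨y₀, hy₀⟩ := hodd
  have hRM := bb_rmWeight_holds (6 + 6) 1 (fun y => decide (Odd (u' y))) hdeg ⟨y₀, decide_eq_true hy₀⟩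
  have hfilt : (univ.filter fun y : Fin (6 + 6) → Bool => decide (Odd (u' y)) = true) = univ.filter (fun y => Odd (u' y)) :=
    filter_congr fun y _ => by simp
  rw [hfilt] at hRM
  norm_num at hRM
  omega

/-! ### The even set of a level-`≥ 6` side on the window -/

/-- **`#Z ∈ {512, 768}` on the window, for any partner**: cubic `f, g`, `W_g = 64u''`, `57/64 < Φ < 1` ⇒ `#{u'' even} = 512` or `768`
(`g` is not bent by `tw_bent_end`; the even set is a non-empty cubic support of weight `≤ Σe² ≤ 895`; Kasami–Tokura `kt3_weights_twelve`).
[this work] -/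
theorem tzp_Z_card (f g : (Fin (6 + 6) → Bool) → Bool) (hf : IsDegLeFun 3 f) (hg : IsDegLeFun 3 g)
    (u'' : (Fin (6 + 6) → Bool) → ℤ) (hu'' : ∀ x, W (fun y => signOf (g y)) x = (2 : ℝ) ^ 6 * (u'' x : ℝ))
    (hlo : (57 / 64 : ℝ) < forrelation f g) (hhi : forrelation f g < 1) :
    #(univ.filter fun x : Fin (6 + 6) → Bool => ¬ Odd (u'' x)) = 512 ∨ #(univ.filter fun x : Fin (6 + 6) → Bool => ¬ Odd (u'' x)) = 768 := by
  classical
  set Z := univ.filter (fun x : Fin (6 + 6) → Bool => ¬ Odd (u'' x)) with hZdef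
  obtain ⟨hBR, -, hoffle⟩ := tzw_budget_split f g u'' hu''
  have hB : (∑ x, (u'' x - sZ (f x)) ^ 2 : ℤ) ≤ 895 := by
    have h' : ((∑ x, (u'' x - sZ (f x)) ^ 2 : ℤ) : ℝ) < 896 := by rw [hBR]; linarith
    have h'' : (∑ x, (u'' x - sZ (f x)) ^ 2 : ℤ) < 896 := by exact_mod_cast h'
    omega
  have hoffnn : (0 : ℤ) ≤ ∑ x ∈ univ.filter (fun x => x ∉ Z), (u'' x - sZ (f x)) ^ 2 := sum_nonneg fun x _ => sq_nonneg _
  have hZle : #Z ≤ 895 := by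
    have : (#Z : ℤ) ≤ 895 := by linarith
    exact_mod_cast this
  -- Parseval: `Σ u''² = 4096`; `g` is not bent
  have hpar : ∑ x, u'' x ^ 2 = 4096 := by
    have h := zms_sum_u_sq 2 g (fun x => 4 * u'' x) (fun x => by rw [hu'' x]; push_cast; ring)
    have e4 : ∑ x, (((4 * u'' x : ℤ)) : ℝ) ^ 2 = 16 * ∑ x, ((u'' x : ℝ)) ^ 2 := by
      rw [mul_sum]; exact sum_congr rfl fun x _ => by push_cast; ring
    rw [e4] at h
    norm_num at h
    have h' : ∑ x, ((u'' x : ℝ)) ^ 2 = 4096 := by linarith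
    exact_mod_cast h'
  have hnotall : ∃ x₁, ¬ Odd (u'' x₁) := by
    by_contra hall
    push Not at hall
    have hsq1' : ∀ x, u'' x ^ 2 = 1 := by
      have hge : ∀ x, (1 : ℤ) ≤ u'' x ^ 2 := fun x => by
        have h0 := Int.odd_iff.1 (hall x)
        have : u'' x ≤ -1 ∨ 1 ≤ u'' x := by omega
        have := tp_sq_ge (k := 1) (by norm_num) this
        linarith
      have hsum0 : ∑ x, (u'' x ^ 2 - 1 : ℤ) = 0 := by
        rw [sum_sub_distrib, hpar, sum_const, card_univ, Fintype.card_fun, Fintype.card_bool, Fintype.card_fin]; norm_num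
      intro x
      have := (sum_eq_zero_iff_of_nonneg fun y _ => by have := hge y; linarith).1 hsum0 x (mem_univ x)
      linarith
    have hbent : ∀ x, W (fun y => signOf (g y)) x ^ 2 = (2 : ℝ) ^ (6 + 6) := by
      intro x
      rw [hu'' x, mul_pow]
      have : ((u'' x : ℝ)) ^ 2 = 1 := by exact_mod_cast hsq1' x
      rw [this]; norm_num
    rcases tw_bent_end (by norm_num) f g hf hg hbent with h | h
    · rw [h] at hhi; exact lt_irrefl _ hhi
    · norm_num at h; linarith
  obtain ⟨x₁, hx₁⟩ := hnotall
  have hp : IsDegLeFun 3 (fun x => decide (Odd (u'' x))) :=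
    stub_walshTower stub_axParity (6 + 6) 6 3 g u'' hg hu'' (by intro k hk hkn; omega)
  have hp' : IsDegLeFun 3 (fun x => decide (Odd (u'' x)) ^^ true) := tb_isDegLeFun_xor_const hp true
  have hfilt : (univ.filter fun x : Fin (6 + 6) → Bool => (decide (Odd (u'' x)) ^^ true) = true) = Z :=
    filter_congr fun x _ => by simp
  have hne : ∃ x, (decide (Odd (u'' x)) ^^ true) = true := ⟨x₁, by simpa using hx₁⟩
  have hRM := bb_rmWeight_holds (6 + 6) 3 (fun x => decide (Odd (u'' x)) ^^ true) hp' hne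
  rw [hfilt] at hRM
  have hZge : 512 ≤ #Z := by norm_num at hRM; omega
  have hkt := kt3_weights_twelve (fun x => decide (Odd (u'' x)) ^^ true) hp' (by rw [hfilt]; omega)
  rw [hfilt] at hkt
  rcases hkt with h | h | h | h | h | h
  · omega
  · exact Or.inl h
  · exact Or.inr h
  · omega
  · omega
  · omega

/-- **`#Z = 512` makes `Z` a 9-flat `x_Z ⊕ V₀`** (`mw_flat_of_minweight` on the cubic `[u'' even]`). [this work] -/
theorem tzp_flat512 (g : (Fin (6 + 6) → Bool) → Bool) (hg : IsDegLeFun 3 g)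
    (u'' : (Fin (6 + 6) → Bool) → ℤ) (hu'' : ∀ x, W (fun y => signOf (g y)) x = (2 : ℝ) ^ 6 * (u'' x : ℝ))
    (h512 : #(univ.filter fun x : Fin (6 + 6) → Bool => ¬ Odd (u'' x)) = 512) :
    ∃ (V₀ : Finset (Fin (6 + 6) → Bool)) (xZ : Fin (6 + 6) → Bool), zeroVec ∈ V₀ ∧ (∀ a ∈ V₀, ∀ b ∈ V₀, bxor a b ∈ V₀) ∧ #V₀ = 512 ∧
      (univ.filter fun x : Fin (6 + 6) → Bool => ¬ Odd (u'' x)) = V₀.image (bxor xZ) := by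
  classical
  have hp : IsDegLeFun 3 (fun x => decide (Odd (u'' x))) :=
    stub_walshTower stub_axParity (6 + 6) 6 3 g u'' hg hu'' (by intro k hk hkn; omega)
  have hp' : IsDegLeFun (2 + 1) (fun x => decide (Odd (u'' x)) ^^ true) := tb_isDegLeFun_xor_const hp true
  have hfilt : (univ.filter fun x : Fin (6 + 6) → Bool => (decide (Odd (u'' x)) ^^ true) = true) =
      (univ.filter fun x : Fin (6 + 6) → Bool => ¬ Odd (u'' x)) :=
    filter_congr fun x _ => by simp
  have hmw := mw_flat_of_minweight 2 (fun x => decide (Odd (u'' x)) ^^ true) hp' (by rw [hfilt, h512]; norm_num)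
  rw [hfilt] at hmw
  obtain ⟨h0, hadd, hcardV, hcoset⟩ := hmw
  set V₀ := univ.filter (fun a : Fin (6 + 6) → Bool => ∀ x,
    (decide (Odd (u'' (bxor x a))) ^^ true) = (decide (Odd (u'' x)) ^^ true)) with hV₀
  obtain ⟨xZ, hxZ⟩ : (univ.filter fun x : Fin (6 + 6) → Bool => ¬ Odd (u'' x)).Nonempty := card_pos.1 (by rw [h512]; norm_num)
  have hS : (univ.filter fun x : Fin (6 + 6) → Bool => ¬ Odd (u'' x)) = V₀.image (bxor xZ) :=
    hcoset xZ (by have h := (mem_filter.1 hxZ).2; simpa using h)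
  rw [h512] at hcardV
  exact ⟨V₀, xZ, h0, hadd, hcardV, hS⟩

end Summit.QuantumAdvantage.QuantumAdvantage.Theorems.CubicForrelation.NearExactIsExact

end
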